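import Summits.CriticalPhenomena.PercolationContinuityZ3.Theorems.PercNearOneGluingNoHeavyLowerTailGuardedCIL
import Summits.CriticalPhenomena.PercolationContinuityZ3.Theorems.PercNearOneGluingNoHeavyLowerTailPrefixPackingTwo
import HarnessLib

/-!
# `NoHeavyLowerTail` (stmt-CriticalPhenomena-4575) — typed reductions for the QUANTITATIVE GAP candidates
# (lemma factory `prim-lf-8`: two-level packing QP_j ⇒ quantitative gap QG_j ⇒ cumulative isolation CIL_j ⇒ crux)

Support file (prover `prim-lf-8`, technique "tie/glue-locus exclusion"; `--supports stmt-CriticalPhenomena-4575`).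
No definitions, no named facts, no sorries.

`μ = prodBernoulli w` on `Fin n`, relays `A`, observer `o ∉ A`, level `j`, `R_a = {|π(a)| ≤ j}` (lightness),
`L = {1 ≤ |π(o)| ≤ j}`.  For a relay `c` and a threshold `t` dominating the lightness of every OTHER relay
(`μ(R_a) ≤ t` for `a ∈ A ∖ c`; e.g. `c` the champion and `t` the runner-up value `S₂`):

* **QG_j(c,t)** (quantitative gap):   `μ(L) ≤ μ(o ↔ c)·μ(R_c) + (1 − μ(o ↔ c))·t`
  — "CIL is strict off the tie ∪ glue locus by `(μ(R_c) − t)·μ(o ↮ c)`"; proved at level 1 (`Theorems.quantGapOne`).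
* **QP_j(c,t)** (two-level packing): `μ({o ↮ c} ∩ L)·μ(R_c) ≤ μ({o ↮ c} ∩ R_c)·t`
  — "given `o` and `c` are apart, odds(o small-nonempty : c light) ≤ t/μ(R_c)".

This file: `quantGap_of_twoLevelPacking` (QP ⇒ QG at the same `(c,t)` whenever `t ≤ μ(R_c)`; one Harris step
`μ({o ↔ c} ∩ R_c) ≤ μ(o ↔ c)·μ(R_c)`, `{o ↔ c}` increasing, `R_c` decreasing), `cumulativeIsolation_of_quantGap`
(QG at champions ⇒ `stub_cumulativeIsolation`), `noHeavyLowerTail_of_quantGap`, `noHeavyLowerTail_of_twoLevelPacking`.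
Both candidates: 0 violations in the seat's exhaustive exact census (all essential graphs on `{o, a₁..a₅}`, 19 weight
families, `j = 1,2,3`: 47 196 (instance, level) cases) and in ttrl2-style corner families / adversarial climbs (`n ≤ 7`);
censuses `lf8-qg-quantitative-gap`, `lf8-qp-two-level-packing` filed (run/shared/lean/prim/prim-lf-8/CANDIDATES.md).
-/

noncomputable section

namespace Summit.CriticalPhenomena.PercolationContinuityZ3.Theorems

open MeasureTheory Set Literature.Probability.LatticeModels Literature.Probability.Percolation
open scoped Classical BigOperators

variable {n : ℕ}

namespace QuantGap

/-- `L = ({o ↔ c} ∩ L) ∪ ({o ↮ c} ∩ L)` as a sum of probabilities, and on `{o ↔ c}` the observer's block is the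
champion's block: `μ(L) = μ({o ↔ c} ∩ R_c ∩ {1 ≤ N}) + μ({o ↮ c} ∩ L) ≤ μ({o ↔ c} ∩ R_c) + μ({o ↮ c} ∩ L)`. [folklore] -/
theorem real_L_le_split (w : Sym2 (Fin n) → unitInterval) (A : Finset (Fin n)) (o c : Fin n) (j : ℕ) :
    (prodBernoulli w).real {ω : BondConfig (Fin n) |
        1 ≤ (A.filter fun x => ω ∈ openConn o x).card ∧ (A.filter fun x => ω ∈ openConn o x).card ≤ j} ≤
      (prodBernoulli w).real ((openConn o c : Set (BondConfig (Fin n))) ∩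
          {ω | (A.filter fun x => ω ∈ openConn c x).card ≤ j}) +
        (prodBernoulli w).real ((openConn o c : Set (BondConfig (Fin n)))ᶜ ∩
          {ω | 1 ≤ (A.filter fun x => ω ∈ openConn o x).card ∧
            (A.filter fun x => ω ∈ openConn o x).card ≤ j}) := by
  have hsub : {ω : BondConfig (Fin n) |
        1 ≤ (A.filter fun x => ω ∈ openConn o x).card ∧ (A.filter fun x => ω ∈ openConn o x).card ≤ j} ⊆
      ((openConn o c : Set (BondConfig (Fin n))) ∩ {ω | (A.filter fun x => ω ∈ openConn c x).card ≤ j}) ∪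
        ((openConn o c : Set (BondConfig (Fin n)))ᶜ ∩
          {ω | 1 ≤ (A.filter fun x => ω ∈ openConn o x).card ∧
            (A.filter fun x => ω ∈ openConn o x).card ≤ j}) := by
    rintro ω ⟨h1, hj⟩
    by_cases hoc : ω ∈ (openConn o c : Set (BondConfig (Fin n)))
    · left
      refine ⟨hoc, ?_⟩
      show (A.filter fun x => ω ∈ openConn c x).card ≤ j
      rw [GuardedCIL.filter_eq_of_reachable A hoc]; exact hj
    · right; exact ⟨hoc, h1, hj⟩
  exact (measureReal_mono hsub (measure_ne_top _ _)).trans (measureReal_union_le _ _)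

/-- Harris for the champion's own connection: `μ({o ↔ c} ∩ R_c) ≤ μ(o ↔ c)·μ(R_c)`. [folklore] -/
theorem real_conn_inter_light_le (w : Sym2 (Fin n) → unitInterval) (A : Finset (Fin n)) (o c : Fin n) (j : ℕ) :
    (prodBernoulli w).real ((openConn o c : Set (BondConfig (Fin n))) ∩
        {ω | (A.filter fun x => ω ∈ openConn c x).card ≤ j}) ≤
      (prodBernoulli w).real (openConn o c : Set (BondConfig (Fin n))) *
        (prodBernoulli w).real {ω : BondConfig (Fin n) | (A.filter fun x => ω ∈ openConn c x).card ≤ j} :=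
  prodBernoulli_harris_upper_lower w (isUpperSet_openConn o c) (PrefixPacking.isLowerSet_cardLe A c j)
    MeasurableSet.of_discrete MeasurableSet.of_discrete

end QuantGap

open QuantGap

/-- **Two-level packing ⇒ quantitative gap** (QP ⇒ QG, same relay `c` and threshold `t`, `μ(R_a) ≤ t ≤ μ(R_c)` for
`a ∈ A ∖ c`).  From `μ({o ↮ c} ∩ L)·μ(R_c) ≤ μ({o ↮ c} ∩ R_c)·t` one gets `μ(L) ≤ μ(o ↔ c)·μ(R_c) + (1 − μ(o ↔ c))·t`:
with `θ = μ({o↔c} ∩ R_c)/μ(R_c) ≤ μ(o ↔ c)` (Harris), `μ(L) ≤ θ·μ(R_c) + (1 − θ)·t`, increasing in `θ` since `t ≤ μ(R_c)`. -/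
theorem quantGap_of_twoLevelPacking (w : Sym2 (Fin n) → unitInterval) (A : Finset (Fin n)) (o c : Fin n)
    (j : ℕ) (t : ℝ) (ht : 0 ≤ t)
    (hdom : ∀ a ∈ A, a ≠ c →
      (prodBernoulli w).real {ω : BondConfig (Fin n) | (A.filter fun x => ω ∈ openConn a x).card ≤ j} ≤ t)
    (htc : t ≤ (prodBernoulli w).real {ω : BondConfig (Fin n) | (A.filter fun x => ω ∈ openConn c x).card ≤ j})
    (hQP : (prodBernoulli w).real ((openConn o c : Set (BondConfig (Fin n)))ᶜ ∩
          {ω | 1 ≤ (A.filter fun x => ω ∈ openConn o x).card ∧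
            (A.filter fun x => ω ∈ openConn o x).card ≤ j}) *
        (prodBernoulli w).real {ω : BondConfig (Fin n) | (A.filter fun x => ω ∈ openConn c x).card ≤ j} ≤
      (prodBernoulli w).real ((openConn o c : Set (BondConfig (Fin n)))ᶜ ∩
          {ω | (A.filter fun x => ω ∈ openConn c x).card ≤ j}) * t) :
    (prodBernoulli w).real {ω : BondConfig (Fin n) |
        1 ≤ (A.filter fun x => ω ∈ openConn o x).card ∧ (A.filter fun x => ω ∈ openConn o x).card ≤ j} ≤
      (prodBernoulli w).real (openConn o c : Set (BondConfig (Fin n))) *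
          (prodBernoulli w).real {ω : BondConfig (Fin n) | (A.filter fun x => ω ∈ openConn c x).card ≤ j} +
        (1 - (prodBernoulli w).real (openConn o c : Set (BondConfig (Fin n)))) * t := by
  set μ := prodBernoulli w with hμ
  set Rc : Set (BondConfig (Fin n)) := {ω | (A.filter fun x => ω ∈ openConn c x).card ≤ j} with hRc
  set Lev : Set (BondConfig (Fin n)) := {ω | 1 ≤ (A.filter fun x => ω ∈ openConn o x).card ∧
    (A.filter fun x => ω ∈ openConn o x).card ≤ j} with hLev
  set E : Set (BondConfig (Fin n)) := (openConn o c : Set (BondConfig (Fin n))) with hE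
  have hsplit : μ.real Lev ≤ μ.real (E ∩ Rc) + μ.real (Eᶜ ∩ Lev) := real_L_le_split w A o c j
  have hharris : μ.real (E ∩ Rc) ≤ μ.real E * μ.real Rc := real_conn_inter_light_le w A o c j
  have hRsplit : μ.real Rc = μ.real (E ∩ Rc) + μ.real (Eᶜ ∩ Rc) := by
    have hEm : MeasurableSet E := MeasurableSet.of_discrete
    have h : μ.real (Rc ∩ E) + μ.real (Rc \ E) = μ.real Rc := measureReal_inter_add_sdiff₀ (s := Rc) hEm.nullMeasurableSet
    rw [Set.inter_comm Rc E, Set.sdiff_eq, Set.inter_comm Rc Eᶜ] at h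
    exact h.symm
  have hp0 : 0 ≤ μ.real E := measureReal_nonneg
  have hp1 : μ.real E ≤ 1 := measureReal_le_one
  have hR0 : 0 ≤ μ.real Rc := measureReal_nonneg
  have hER0 : 0 ≤ μ.real (E ∩ Rc) := measureReal_nonneg
  have hEcR0 : 0 ≤ μ.real (Eᶜ ∩ Rc) := measureReal_nonneg
  have hEL0 : 0 ≤ μ.real (Eᶜ ∩ Lev) := measureReal_nonneg
  by_cases hRzero : μ.real Rc = 0
  · -- then `t = 0`, every relay is a.s. heavy, and `L ⊆ ⋃_a R_a` is null
    have ht0 : t = 0 := le_antisymm (htc.trans (le_of_eq hRzero)) ht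
    have hLsub : Lev ⊆ ⋃ a ∈ A, {ω : BondConfig (Fin n) | (A.filter fun x => ω ∈ openConn a x).card ≤ j} := by
      rintro ω ⟨h1, hj⟩
      obtain ⟨a, ha⟩ := Finset.card_pos.1 h1
      obtain ⟨haA, hoa⟩ := Finset.mem_filter.1 ha
      refine Set.mem_iUnion₂.2 ⟨a, haA, ?_⟩
      show (A.filter fun x => ω ∈ openConn a x).card ≤ j
      rw [GuardedCIL.filter_eq_of_reachable A hoa]; exact hj
    have hLle : μ.real Lev ≤
        ∑ a ∈ A, μ.real {ω : BondConfig (Fin n) | (A.filter fun x => ω ∈ openConn a x).card ≤ j} :=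
      (measureReal_mono hLsub (measure_ne_top _ _)).trans (measureReal_biUnion_finset_le A _)
    have hsum0 : ∑ a ∈ A, μ.real {ω : BondConfig (Fin n) | (A.filter fun x => ω ∈ openConn a x).card ≤ j} ≤ 0 := by
      refine Finset.sum_nonpos fun a ha => ?_
      by_cases hac : a = c
      · rw [hac]; exact le_of_eq hRzero
      · exact (hdom a ha hac).trans (le_of_eq ht0)
    have hL0 : μ.real Lev ≤ 0 := hLle.trans hsum0
    rw [hRzero, ht0]
    linarith
  · have hRpos : 0 < μ.real Rc := lt_of_le_of_ne hR0 (Ne.symm hRzero)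
    have key : μ.real Lev * μ.real Rc ≤ μ.real (E ∩ Rc) * μ.real Rc + μ.real (Eᶜ ∩ Rc) * t := by
      have h1 : μ.real Lev * μ.real Rc ≤ (μ.real (E ∩ Rc) + μ.real (Eᶜ ∩ Lev)) * μ.real Rc :=
        mul_le_mul_of_nonneg_right hsplit hR0
      nlinarith [hQP]
    -- `μ(E∩Rc)·μ(Rc) + μ(Eᶜ∩Rc)·t = t·μ(Rc) + μ(E∩Rc)·(μ(Rc) − t) ≤ t·μ(Rc) + μ(E)·μ(Rc)·(μ(Rc) − t)`
    have hmono : μ.real (E ∩ Rc) * (μ.real Rc - t) ≤ μ.real E * μ.real Rc * (μ.real Rc - t) :=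
      mul_le_mul_of_nonneg_right hharris (by linarith)
    have key2 : μ.real Lev * μ.real Rc ≤ (μ.real E * μ.real Rc + (1 - μ.real E) * t) * μ.real Rc := by
      have : μ.real (E ∩ Rc) * μ.real Rc + μ.real (Eᶜ ∩ Rc) * t =
          t * μ.real Rc + μ.real (E ∩ Rc) * (μ.real Rc - t) := by rw [hRsplit]; ring
      nlinarith
    exact le_of_mul_le_mul_right key2 hRpos

/-- **Quantitative gap at champions ⇒ the cumulative isolation lemma** (`stub_cumulativeIsolation`): the QG bound at a
champion `c` with `t` = the runner-up lightness is at most `μ(R_c)`. -/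
theorem cumulativeIsolation_of_quantGap
    (hQG : ∀ (n : ℕ) (w : Sym2 (Fin n) → unitInterval) (A : Finset (Fin n)) (o c : Fin n) (j : ℕ) (t : ℝ),
      o ∉ A → c ∈ A → 0 ≤ t →
      (∀ a ∈ A, a ≠ c →
        (prodBernoulli w).real {ω : BondConfig (Fin n) | (A.filter fun x => ω ∈ openConn a x).card ≤ j} ≤ t) →
      t ≤ (prodBernoulli w).real {ω : BondConfig (Fin n) | (A.filter fun x => ω ∈ openConn c x).card ≤ j} →
      (prodBernoulli w).real {ω : BondConfig (Fin n) |
          1 ≤ (A.filter fun x => ω ∈ openConn o x).card ∧ (A.filter fun x => ω ∈ openConn o x).card ≤ j} ≤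
        (prodBernoulli w).real (openConn o c : Set (BondConfig (Fin n))) *
            (prodBernoulli w).real {ω : BondConfig (Fin n) | (A.filter fun x => ω ∈ openConn c x).card ≤ j} +
          (1 - (prodBernoulli w).real (openConn o c : Set (BondConfig (Fin n)))) * t) :
    ∀ (n : ℕ) (w : Sym2 (Fin n) → unitInterval) (A : Finset (Fin n)) (o : Fin n) (j : ℕ),
      A.Nonempty → o ∉ A → ∃ a ∈ A,
        (Literature.Probability.LatticeModels.prodBernoulli w).real
            {ω : Literature.Probability.Percolation.BondConfig (Fin n) |
              1 ≤ (A.filter fun x => ω ∈ Literature.Probability.Percolation.openConn o x).card ∧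
                (A.filter fun x => ω ∈ Literature.Probability.Percolation.openConn o x).card ≤ j} ≤
          (Literature.Probability.LatticeModels.prodBernoulli w).real
            {ω : Literature.Probability.Percolation.BondConfig (Fin n) |
              (A.filter fun x => ω ∈ Literature.Probability.Percolation.openConn a x).card ≤ j} := by
  intro n w A o j hA ho
  let S : Fin n → ℝ := fun a =>
    (prodBernoulli w).real {ω : BondConfig (Fin n) | (A.filter fun x => ω ∈ openConn a x).card ≤ j}
  obtain ⟨c, hc, hmax⟩ := Finset.exists_max_image A S hA
  refine ⟨c, hc, ?_⟩
  -- threshold `t = μ(R_c)` itself (any `t` between the runner-up and `μ(R_c)` would do)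
  have h := hQG n w A o c j (S c) ho hc measureReal_nonneg (fun a ha _ => hmax a ha) le_rfl
  have hp0 : 0 ≤ (prodBernoulli w).real (openConn o c : Set (BondConfig (Fin n))) := measureReal_nonneg
  have hp1 : (prodBernoulli w).real (openConn o c : Set (BondConfig (Fin n))) ≤ 1 := measureReal_le_one
  have hS0 : 0 ≤ S c := measureReal_nonneg
  calc (prodBernoulli w).real _ ≤ _ := h
    _ = S c := by simp only [S]; ring

/-- **QG at champions closes the crux `NoHeavyLowerTail`.** -/
theorem noHeavyLowerTail_of_quantGap
    (hQG : ∀ (n : ℕ) (w : Sym2 (Fin n) → unitInterval) (A : Finset (Fin n)) (o c : Fin n) (j : ℕ) (t : ℝ),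
      o ∉ A → c ∈ A → 0 ≤ t →
      (∀ a ∈ A, a ≠ c →
        (prodBernoulli w).real {ω : BondConfig (Fin n) | (A.filter fun x => ω ∈ openConn a x).card ≤ j} ≤ t) →
      t ≤ (prodBernoulli w).real {ω : BondConfig (Fin n) | (A.filter fun x => ω ∈ openConn c x).card ≤ j} →
      (prodBernoulli w).real {ω : BondConfig (Fin n) |
          1 ≤ (A.filter fun x => ω ∈ openConn o x).card ∧ (A.filter fun x => ω ∈ openConn o x).card ≤ j} ≤
        (prodBernoulli w).real (openConn o c : Set (BondConfig (Fin n))) *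
            (prodBernoulli w).real {ω : BondConfig (Fin n) | (A.filter fun x => ω ∈ openConn c x).card ≤ j} +
          (1 - (prodBernoulli w).real (openConn o c : Set (BondConfig (Fin n)))) * t) :
    Summit.CriticalPhenomena.PercolationContinuityZ3.Theses.PercNearOneGluing.NoHeavyLowerTail :=
  noHeavyLowerTail_of_stub_cumulativeIsolation (cumulativeIsolation_of_quantGap hQG)

/-- **Two-level packing (all graphs, relays `c`, admissible thresholds) closes the crux `NoHeavyLowerTail`**, through
`quantGap_of_twoLevelPacking` and `noHeavyLowerTail_of_quantGap`. -/
theorem noHeavyLowerTail_of_twoLevelPacking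
    (hQP : ∀ (n : ℕ) (w : Sym2 (Fin n) → unitInterval) (A : Finset (Fin n)) (o c : Fin n) (j : ℕ) (t : ℝ),
      o ∉ A → c ∈ A → 0 ≤ t →
      (∀ a ∈ A, a ≠ c →
        (prodBernoulli w).real {ω : BondConfig (Fin n) | (A.filter fun x => ω ∈ openConn a x).card ≤ j} ≤ t) →
      t ≤ (prodBernoulli w).real {ω : BondConfig (Fin n) | (A.filter fun x => ω ∈ openConn c x).card ≤ j} →
      (prodBernoulli w).real ((openConn o c : Set (BondConfig (Fin n)))ᶜ ∩
          {ω | 1 ≤ (A.filter fun x => ω ∈ openConn o x).card ∧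
            (A.filter fun x => ω ∈ openConn o x).card ≤ j}) *
        (prodBernoulli w).real {ω : BondConfig (Fin n) | (A.filter fun x => ω ∈ openConn c x).card ≤ j} ≤
      (prodBernoulli w).real ((openConn o c : Set (BondConfig (Fin n)))ᶜ ∩
          {ω | (A.filter fun x => ω ∈ openConn c x).card ≤ j}) * t) :
    Summit.CriticalPhenomena.PercolationContinuityZ3.Theses.PercNearOneGluing.NoHeavyLowerTail :=
  noHeavyLowerTail_of_quantGap fun n w A o c j t ho hc ht hdom htc =>
    quantGap_of_twoLevelPacking w A o c j t ht hdom htc (hQP n w A o c j t ho hc ht hdom htc)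

end Summit.CriticalPhenomena.PercolationContinuityZ3.Theorems

end
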